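import Summits.CriticalPhenomena.CardyFormulaZ2.Theses.CardyMeckeFlip
import Literature.Probability.Percolation.FlipFairKernel
import Literature.Probability.Percolation.Z2PivotalMeasure
import Literature.Probability.Percolation.BlockResampling
import Summits.CriticalPhenomena.CardyFormulaZ2.Theorems.CardyMeckeFlipFlipErgodicityZ2StubFlipExtremalOfTrivialDensity
import HarnessLib

/-!
# Line `coupling` — crux `FlipErgodicityZ2` (stmt-CriticalPhenomena-14825), route CardyMeckeFlip

Strategist line (crux-strategist s2, 2026-08-17), an ALTERNATIVE to `Lines/birth.lean` for the
ERGODIC HALF of the crux (birth stub 3 `stub_pivotalKernelErgodic` = GPS 2018 §12.1's open question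
for `ℤ²` sublimits, for which the birth line has no plan short of porting GHSS 2021 §6 — continuum
dynamics + continuum spectral samples — to `ℤ²`).

THE LEVER ("two-time coupling").  Flip-invariance of a bounded flip-fair density `f` (i.e.
`f·μ` flip-fair at every cutoff) is tested not against a continuum dynamics (which does not exist
for `ℤ²` sublimits) but against SUBSEQUENTIAL TWO-TIME COUPLINGS `π_t` on `ℋ × ℋ`: weak limits,
along the mesh sequence of `μ`, of the law of `(ω₀, ω_t)` for the NO-CUTOFF edge-resampling
dynamics of bond-`ℤ²` run at the GPS rate `pivotalRate δ = δ²/α₄(δ,1)` per edge (at mesh `δ` the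
time-`t` configuration is `resample U (ω₀, ω')` with `ω'` an independent copy and `U` a
Bernoulli-`(1 - e^{-r(δ)t})` edge set — `BlockResampling.resample`, all in the tree).  Everything
is EXACT on the lattice (reversibility, forward equation `d/dt E[w(ω₀)k(ω_t)] = E[(L w)(ω₀)k(ω_t)]`,
self-adjointness of the cutoff generator `L^ε_δ`, the one-line bound
`‖L^ε_δ P_s k‖₂ ≤ 2‖k‖∞ ‖N_k‖₂` with `N_k` the normalised pivotal count of `k`'s quads) and is
passed to the limit ONCE, through Campbell-type functionals of the kind node (C) of the birth line
already handles; decorrelation `‖P_t k̃‖₂ → 0` uniformly in `δ` is GPS10's LATTICE lower-tail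
tightness of the spectral sample, printed for bond-`ℤ²` (Acta Math. 205, Thm 1.1 + (1.2)), with the
multi-quad extension of GHSS 2021 App. §10 (printed for `𝕋`, inputs `ℤ²`-valid).  NO continuum
dynamics, NO continuum spectral sample, NO GPS18 stability / `ε → 0` generator identification, NO
Markov property of the limit are needed — that is the why-easier versus GHSS-for-`ℤ²`.

THE ARGUMENT (stub 6, soft): for a nice cylinder `k` put `Δ_t(v) := ∫ v(S₀)k(S) dπ_t − ∫ v k dμ`
(`|Δ_t(v) − Δ_t(v')| ≤ 2‖k‖∞‖v − v'‖_{L¹(μ)}` since both marginals of `π_t` are `μ`).  Stub 5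
gives `G_ε ∈ L²(μ)`, `‖G_ε‖₂² ≤ C` uniformly in `ε`, `G_ε ⊥ every flip-fair bounded density`, and
`Δ_t(w) = t⟨w, G_ε⟩ + o_{ε→0}(1)` for each nice cylinder `w`.  For cylinders `w_n → f` in `L²(μ)`:
`|Δ_t(f)| ≤ 2‖k‖∞‖f − w_n‖₁ + t√C‖w_n − f‖₂ + |o_ε(1)|` (using `⟨w_n, G_ε⟩ = ⟨w_n − f, G_ε⟩`), so
`Δ_t(f) = 0` (INVARIANCE of `f` under every two-time coupling).  Stub 4 (decorrelation) then gives
`|∫ f (k − μk) dμ| = |∫ f(S₀)(k − μk)(S) dπ_t| ≤ η` for every `η`, so `f·μ = μ` on the nice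
cylinder π-system, which generates the Borel σ-algebra (stub 3 + `SchrammSmirnov2011_thm_1_4_holds`).

NICE quads = restrictions of `C¹` immersions of a neighbourhood of the square (inline predicate;
dense by the conformal-chart shrink of `QuadCrossingGeneralPosition`): the boundary three-arm
estimates (stub 5's cutoff error) and GHSS App. §10 Prop. 10.3 want piecewise-smooth boundaries —
this answers the leads' R1 recommendation ("restrict to a countable tame quad family") inside the
line instead of inside the crux.

Stubs 1–2 are the canonical-kernel half, shared verbatim with the K1-pinned split children
`CanonicalKernelZ2`, `CanonicalKernelFlipFairZ2` (glue `flipErgodicityZ2_of_subs`, landed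
p172226); stubs 3–6 replace birth stub 3.  Isometry-EQUIVARIANCE of the kernel is NOT used by the
ergodic half of this line.  Card: `Lines/coupling.md`.
-/

noncomputable section

open MeasureTheory Filter Set Function Topology
open scoped unitInterval ENNReal NNReal
open Literature.Probability.Percolation Literature.Probability.Percolation.QuadCrossing
open Literature.Probability.LatticeModels

namespace Summit.CriticalPhenomena.CardyFormulaZ2.Cruxes.FlipErgodicityZ2.Coupling

/-- **Split glue** `C₁ → C₂ → C₃ → FlipErgodicityZ2` — verbatim copy of the LANDED theorem
`Summit.CriticalPhenomena.CardyFormulaZ2.Theorems.CardyMeckeFlip.flipErgodicityZ2_of_subs`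
(`Theorems/CardyMeckeFlipFlipErgodicityZ2Split.lean`, p172226), inlined so that this skeleton does
not depend on that module's build state. [folklore] -/
theorem flipErgodicityZ2_of_subs' :
    (∀ μ : FiniteMeasure (QuadConfig (univ : Set ℂ)), μ ∈ subseqQuadLimits (univ : Set ℂ) → ∃ M : ℝ → QuadConfig (univ : Set ℂ) → Measure ℂ, IsZ2PivotalKernelLimit μ M ∧ IsAdmissibleKernel (μ : Measure (QuadConfig (univ : Set ℂ))) M ∧ IsIsometryEquivariant M) → (∀ (μ : FiniteMeasure (QuadConfig (univ : Set ℂ))) (M : ℝ → QuadConfig (univ : Set ℂ) → Measure ℂ), IsZ2PivotalKernelLimit μ M → IsAdmissibleKernel (μ : Measure (QuadConfig (univ : Set ℂ))) M → ∀ ε : ℝ, 0 < ε → IsFlipFairKernel (μ : Measure (QuadConfig (univ : Set ℂ))) (M ε)) →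
    (∀ (μ : FiniteMeasure (QuadConfig (univ : Set ℂ))) (M : ℝ → QuadConfig (univ : Set ℂ) → Measure ℂ),
      IsZ2PivotalKernelLimit μ M → IsAdmissibleKernel (μ : Measure (QuadConfig (univ : Set ℂ))) M → IsIsometryEquivariant M →
      (∀ ε : ℝ, 0 < ε → IsFlipFairKernel (μ : Measure (QuadConfig (univ : Set ℂ))) (M ε)) →
      ∀ f : QuadConfig (univ : Set ℂ) → ℝ≥0∞, Measurable f → (∀ S, f S ≤ 2) →
      IsProbabilityMeasure ((μ : Measure (QuadConfig (univ : Set ℂ))).withDensity f) →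
      (∀ ε : ℝ, 0 < ε → IsFlipFairKernel ((μ : Measure (QuadConfig (univ : Set ℂ))).withDensity f) (M ε)) →
      (μ : Measure (QuadConfig (univ : Set ℂ))).withDensity f = (μ : Measure (QuadConfig (univ : Set ℂ)))) →
    Summit.CriticalPhenomena.CardyFormulaZ2.Theses.CardyMeckeFlip.FlipErgodicityZ2 := by
  intro hK hF hErg Piv hPiv μ hμ
  obtain rfl : Piv = fun S x Q => QuadConfig.IsPivotalAt S x Q :=
    QuadConfig.eq_isPivotalAt_of_forall_iff hPiv
  obtain ⟨M, hlim, hadm, hequiv⟩ := hK μ hμ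
  have hff : ∀ ε : ℝ, 0 < ε → IsFlipFairKernel (μ : Measure (QuadConfig (univ : Set ℂ))) (M ε) := hF μ M hlim hadm
  have hext : IsFlipExtremal (μ : Measure (QuadConfig (univ : Set ℂ))) M :=
    Summit.CriticalPhenomena.CardyFormulaZ2.Theorems.CardyMeckeFlip.stub_flipExtremal_of_trivialDensity
      _ M (hErg μ M hlim hadm hequiv hff)
  refine ⟨M, (isAdmissibleKernel_and_isIsometryEquivariant_iff _ M).1 ⟨hadm, hequiv⟩, ?_, ?_⟩
  · intro ε hε
    exact (isFlipFairKernel_iff _ _).1 (hff ε hε)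
  · exact (isFlipExtremal_iff _ M).1 hext

/-- **Stub 1 (shared with the split child `CanonicalKernelZ2` / birth node 1): the canonical
GPS pivotal kernel exists on every `ℤ²` sublimit**, admissible and isometry-equivariant.
[birth line: stub_kernelExistsZ2_of_lattice ⇐ zdFourArmFacts, jointKernelLimit, pivotalSupport,
rotationInvariantLimits, equivariantVersion; GPS 2013 Thm 1.1/4.3, §4.7; DKKMO 2020] -/
theorem stub_canonicalKernelZ2 : ∀ μ : FiniteMeasure (QuadConfig (univ : Set ℂ)), μ ∈ subseqQuadLimits (univ : Set ℂ) → ∃ M : ℝ → QuadConfig (univ : Set ℂ) → Measure ℂ, IsZ2PivotalKernelLimit μ M ∧ IsAdmissibleKernel (μ : Measure (QuadConfig (univ : Set ℂ))) M ∧ IsIsometryEquivariant M := by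
  sorry

/-- **Stub 2 (shared with the split child `CanonicalKernelFlipFairZ2` / birth node 2b): the flip
identity passes to the limit for the canonical kernel** (closed modulo node (C) in the birth line:
`flipPassesToLimit_of_nodeC`, p163085). [GPS 2018 §11.1; GPS 2013] -/
theorem stub_canonicalFlipFairZ2 : ∀ (μ : FiniteMeasure (QuadConfig (univ : Set ℂ))) (M : ℝ → QuadConfig (univ : Set ℂ) → Measure ℂ), IsZ2PivotalKernelLimit μ M → IsAdmissibleKernel (μ : Measure (QuadConfig (univ : Set ℂ))) M → ∀ ε : ℝ, 0 < ε → IsFlipFairKernel (μ : Measure (QuadConfig (univ : Set ℂ))) (M ε) := by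
  sorry

/-- **Stub 3: nice (C¹-immersed) quads are dense in `𝒬_ℂ`.**  Proof plan: conformal chart of a
quad (`exists_conformalChart`, `QuadCrossingGeneralPosition.lean`) shrunk by `1 - u` is a
real-analytic immersion of a neighbourhood of the square, `u → 0` close to `Q`. [size M] -/
theorem stub_niceQuadsDense : Dense {Q : Quad (univ : Set ℂ) | (∃ (U : Set (ℝ × ℝ)) (Φ : ℝ × ℝ → ℂ), IsOpen U ∧ (∀ z : unitInterval × unitInterval, (((z.1 : ℝ), (z.2 : ℝ)) : ℝ × ℝ) ∈ U ∧ Φ ((z.1 : ℝ), (z.2 : ℝ)) = Q z) ∧ ContDiffOn ℝ 1 Φ U ∧ ∀ p ∈ U, Function.Injective (fderiv ℝ Φ p))} := by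
  sorry

/-- **Stub 4 (DECORRELATION through two-time couplings; GPS10 on `ℤ²`).**  Along any mesh
sequence realising `μ`, for every nice cylinder `h = g(pattern of Q)` and `η > 0` there are a time
`t` and a subsequential two-time coupling `π_t` of the no-cutoff resampling dynamics such that
`|∫ w(S₀)(h(S) − μh) dπ_t| ≤ η` for every measurable `|w| ≤ 2`.  Lattice core:
`sup_(|w|≤2) E[w(ω₀)h̃(ω_t)] ≤ 2‖P_t h̃‖₂`, `‖P_t h̃‖₂² = E[e^(−2t·r(δ)|𝒮_h|); 𝒮_h ≠ ∅]`, inclusion–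
exclusion of `g` into the monotone events "all quads of `U ⊆ Fin n` crossed", and the LOWER-TAIL
tightness of `r(δ)|𝒮|` uniformly in `δ`: GPS10 Thm 1.1 + (1.2) (printed for bond-`ℤ²`, rectangles;
Thm 1.loc general quads) and GHSS 2021 Thm 10.1 (multi-quad, printed for `𝕋`, proof = GPS10 + SS11).
Limit passage: cylinders are `μ`-a.s. continuity functions (`SchrammSmirnov2011_lemma_5_1_holds`),
compactness of `ℋ × ℋ` (SS11 Thm 1.4 (1)) for the coupling, Lusin for measurable `w`.
Why it might fail: multi-quad lower tail for bond-`ℤ²` is unprinted (GHSS App. §10 is `𝕋`); the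
statement is for NICE quads only. [size XL] -/
theorem stub_twoTimeDecorrelation : ∀ (μ : FiniteMeasure (QuadConfig (univ : Set ℂ))) (δs : ℕ → ℝ), (∀ k, 0 < δs k) → Tendsto δs atTop (𝓝 0) → Tendsto (fun k => z2QuadLaw (univ : Set ℂ) (δs k)) atTop (𝓝 μ) → (∀ (n : ℕ) (Q : Fin n → Quad (univ : Set ℂ)), (∀ i, (∃ (U : Set (ℝ × ℝ)) (Φ : ℝ × ℝ → ℂ), IsOpen U ∧ (∀ z : unitInterval × unitInterval, (((z.1 : ℝ), (z.2 : ℝ)) : ℝ × ℝ) ∈ U ∧ Φ ((z.1 : ℝ), (z.2 : ℝ)) = Q i z) ∧ ContDiffOn ℝ 1 Φ U ∧ ∀ p ∈ U, Function.Injective (fderiv ℝ Φ p))) → ∀ (g : Set (Fin n) → ℝ) (η : ℝ), 0 < η → ∃ t : ℝ, 0 ≤ t ∧ ∃ π : FiniteMeasure (QuadConfig (univ : Set ℂ) × QuadConfig (univ : Set ℂ)), (∃ φ : ℕ → ℕ, StrictMono φ ∧ ∀ F : BoundedContinuousFunction (QuadConfig (univ : Set ℂ) × QuadConfig (univ : Set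 ℂ)) ℝ, Tendsto (fun k => (∫ x, F (z2QuadConfig (univ : Set ℂ) (δs (φ k)) x.1.1, z2QuadConfig (univ : Set ℂ) (δs (φ k)) (resample x.2 (x.1.1, x.1.2))) ∂(((bondPercolation (zdGraph 2) half).prod (bondPercolation (zdGraph 2) half)).prod (bondPercolation (zdGraph 2) (Set.projIcc (0 : ℝ) 1 zero_le_one (1 - Real.exp (-(pivotalRate (δs (φ k)) * t)))))))) atTop (𝓝 (∫ p, F p ∂(π : Measure (QuadConfig (univ : Set ℂ) × QuadConfig (univ : Set ℂ)))))) ∧ ∀ w : QuadConfig (univ : Set ℂ) → ℝ, Measurable w → (∀ S, |w S| ≤ 2) → |∫ p, w p.1 * (g {i | Q i ∈ p.2} - ∫ S, g {i | Q i ∈ S} ∂(μ : Measure (QuadConfig (univ : Set ℂ)))) ∂(π : Measure (QuadConfig (univ : Set ℂ) × QuadConfig (univ : Set ℂ)))| ≤ η) := by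
  sorry

/-- **Stub 5 (TWO-TIME GENERATOR FUNCTIONAL — the line's heart, new).**  For the canonical
flip-fair admissible kernel limit `(μ, M)` along `δs`, every `t ≥ 0`, every two-time coupling `π_t`
and every nice cylinder `k = g(pattern of Q)`: there are `C` and functions `G_ε ∈ L²(μ)` (`ε > 0`)
with (i) measurable, (ii) `‖G_ε‖₂² ≤ C` UNIFORMLY in `ε`, (iii) `⟨f, G_ε⟩_μ = 0` for every bounded
density `f ≤ 2` with `f·μ` flip-fair at all cutoffs (in particular `∫ G_ε dμ = 0`), (iv) for every
nice cylinder `w`: `t⟨w, G_ε⟩_μ → ∫ w(S₀)k(S) dπ_t − ∫ w k dμ` as `ε → 0⁺`.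
Intended witness: `G_ε = L_ε u`, `u(S₀) = E_π̄[k(S) | S₀]` for the TIME-AVERAGED coupling `π̄_t`,
`(L_ε v)(S) = ∫ [v(flip_x S) − v(S)] M_ε(S)(dx)`.  Internal nodes (each lattice-exact + one limit
passage): G1 lattice forward equation with the FULL generator and commutation `[L_δ, P_s] = 0`;
G2 cutoff error `‖(L_δ − L^ε_δ)w_δ‖₁ ≤ e(w, ε) → 0` (only edges pivotal for `w`'s quads within
`O(ε)` of their piecewise-`C¹` boundaries: half-plane 3-arm + corner estimates, GPS 2013 §4.7 type,
`ℤ²`-valid exponents); G3 `‖L^ε_δ ū_δ‖₂ ≤ 2‖g‖∞ ‖N_k‖₂`, `N_k = r(δ)·#(pivotal edges of k's quads)`,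
second moment bounded uniformly (GPS 2013 §4 / birth stub 1b inputs `ZdFourArmQuasiMult`);
G4 two-time node-(C) passage: `E[(L^ε_δ w_δ)(ω₀) k_δ(ω_s)] →` its continuum Campbell form (kernel
coordinate identified with `M_ε(S₀)` because the pair law is a graph — birth N1 — and lattice
pivotality with `IsPivotalAt` — birth p164937/p170937 + node C); G5 flip map `Φ_ε(S, x)` with
Campbell symmetry `⟨L_ε w, u⟩_μ = ⟨w, L_ε u⟩_μ` (involution invariance of `μ ⊗ M_ε` from (F) on a
determining class) and `L_ε u ∈ L²(μ)` at fixed `ε` (second moments); G6 extended flip-fairness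
`⟨f, L_ε u⟩ = 0` for bounded measurable `u` (π-system from (F) for `f·μ`).  Isometry-equivariance
is not used.  Why it might fail: G4/G5 inherit node (C)'s unprinted identification and the
flip-map measurability (R2); G2 needs the boundary 3-arm count on `ℤ²` for `C¹` corners.
[size XXL, every node ≤ XL; no continuum dynamics / spectral sample] -/
theorem stub_twoTimeGenerator : ∀ (μ : FiniteMeasure (QuadConfig (univ : Set ℂ))) (M : ℝ → QuadConfig (univ : Set ℂ) → Measure ℂ) (δs : ℕ → ℝ), (∀ k, 0 < δs k) → Tendsto δs atTop (𝓝 0) → Tendsto (fun k => z2QuadLaw (univ : Set ℂ) (δs k)) atTop (𝓝 μ) → (∀ ε : ℝ, 0 < ε → ∀ (m : ℕ) (φ : Fin m → ℂ → ℝ), (∀ j, Continuous (φ j)) → (∀ j, HasCompactSupport (φ j)) → ∀ F : BoundedContinuousFunction (QuadConfig (univ : Set ℂ) × (Fin m → ℝ)) ℝ, Tendsto (fun k => ∫ ω, F (z2QuadConfig (univ : Set ℂ) (δs k) ω, fun j => ∫ x, φ j x ∂(z2PivotalMeasure ε (δs k) ω)) ∂(bondPercolation (zdGraph 2) half)) atTop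 (𝓝 (∫ S, F (S, fun j => ∫ x, φ j x ∂(M ε S)) ∂(μ : Measure (QuadConfig (univ : Set ℂ)))))) → IsAdmissibleKernel (μ : Measure (QuadConfig (univ : Set ℂ))) M → (∀ ε : ℝ, 0 < ε → IsFlipFairKernel (μ : Measure (QuadConfig (univ : Set ℂ))) (M ε)) → (∀ t : ℝ, 0 ≤ t → ∀ π : FiniteMeasure (QuadConfig (univ : Set ℂ) × QuadConfig (univ : Set ℂ)), (∃ φ : ℕ → ℕ, StrictMono φ ∧ ∀ F : BoundedContinuousFunction (QuadConfig (univ : Set ℂ) × QuadConfig (univ : Set ℂ)) ℝ, Tendsto (fun k => (∫ x, F (z2QuadConfig (univ : Set ℂ) (δs (φ k)) x.1.1, z2QuadConfig (univ : Set ℂ) (δs (φ k)) (resample x.2 (x.1.1, x.1.2))) ∂(((bondPercolation (zdGraph 2) half).prod (bondPercolation (zdGraph 2) half)).prod (bondPercolation (zdGraph 2) (Set.projIcc (0 : ℝ) 1 zero_le_one (1 - Real.exp (-(pivotalRate (δs (φ k)) * t)))))))) atTop (𝓝 (∫ p, F p ∂(π : Measure (QuadConfig (univ : Set ℂ) ×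 QuadConfig (univ : Set ℂ)))))) → ∀ (n : ℕ) (Q : Fin n → Quad (univ : Set ℂ)), (∀ i, (∃ (U : Set (ℝ × ℝ)) (Φ : ℝ × ℝ → ℂ), IsOpen U ∧ (∀ z : unitInterval × unitInterval, (((z.1 : ℝ), (z.2 : ℝ)) : ℝ × ℝ) ∈ U ∧ Φ ((z.1 : ℝ), (z.2 : ℝ)) = Q i z) ∧ ContDiffOn ℝ 1 Φ U ∧ ∀ p ∈ U, Function.Injective (fderiv ℝ Φ p))) → ∀ g : Set (Fin n) → ℝ, (∃ (C : ℝ) (G : ℝ → QuadConfig (univ : Set ℂ) → ℝ), (∀ ε, Measurable (G ε)) ∧ (∀ ε, 0 < ε → ∫ S, (G ε S) ^ 2 ∂(μ : Measure (QuadConfig (univ : Set ℂ))) ≤ C) ∧ (∀ ε, 0 < ε → ∀ f : QuadConfig (univ : Set ℂ) → ℝ≥0∞, Measurable f → (∀ S, f S ≤ 2) → (∀ ε', 0 < ε' → IsFlipFairKernel ((μ : Measure (QuadConfig (univ : Set ℂ))).withDensity f) (M ε')) → ∫ S, (f S).toReal * G ε S ∂(μ : Measure (QuadConfig (univ : Set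 ℂ))) = 0) ∧ (∀ (m : ℕ) (Q' : Fin m → Quad (univ : Set ℂ)), (∀ i, (∃ (U : Set (ℝ × ℝ)) (Φ : ℝ × ℝ → ℂ), IsOpen U ∧ (∀ z : unitInterval × unitInterval, (((z.1 : ℝ), (z.2 : ℝ)) : ℝ × ℝ) ∈ U ∧ Φ ((z.1 : ℝ), (z.2 : ℝ)) = Q' i z) ∧ ContDiffOn ℝ 1 Φ U ∧ ∀ p ∈ U, Function.Injective (fderiv ℝ Φ p))) → ∀ g' : Set (Fin m) → ℝ, Tendsto (fun ε => t * ∫ S, g' {i | Q' i ∈ S} * G ε S ∂(μ : Measure (QuadConfig (univ : Set ℂ)))) (𝓝[>] 0) (𝓝 ((∫ p, g' {i | Q' i ∈ p.1} * g {i | Q i ∈ p.2} ∂(π : Measure (QuadConfig (univ : Set ℂ) × QuadConfig (univ : Set ℂ)))) - ∫ S, g' {i | Q' i ∈ S} * g {i | Q i ∈ S} ∂(μ : Measure (QuadConfig (univ : Set ℂ)))))))) := by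
  sorry

/-- **Stub 6 (SOFT ASSEMBLY: generator functional + decorrelation ⇒ density triviality).**  Pure
measure theory on `ℋ`: the `ε → 0⁺`, `n → ∞` argument of the module docstring gives INVARIANCE
`∫ f(S₀)k(S) dπ_t = ∫ f k dμ` for every two-time coupling and nice cylinder `k` (both marginals of a
coupling are `μ`, from the lattice stationarity `map_resample_prod` and the weak limits; cylinder
functions over a dense quad family are dense in `L²(μ)` by `SchrammSmirnov2011_thm_1_4_holds` (2));
decorrelation then forces `∫ f (k − μk) dμ = 0`, i.e. `f·μ = μ` on a generating π-system
(`ext_of_generate_finite`). [size M–L, provable now] -/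
theorem stub_ergodic_of_generator_and_decorrelation : ∀ (μ : FiniteMeasure (QuadConfig (univ : Set ℂ))) (M : ℝ → QuadConfig (univ : Set ℂ) → Measure ℂ) (δs : ℕ → ℝ), (∀ k, 0 < δs k) → Tendsto δs atTop (𝓝 0) → Tendsto (fun k => z2QuadLaw (univ : Set ℂ) (δs k)) atTop (𝓝 μ) → Dense {Q : Quad (univ : Set ℂ) | (∃ (U : Set (ℝ × ℝ)) (Φ : ℝ × ℝ → ℂ), IsOpen U ∧ (∀ z : unitInterval × unitInterval, (((z.1 : ℝ), (z.2 : ℝ)) : ℝ × ℝ) ∈ U ∧ Φ ((z.1 : ℝ), (z.2 : ℝ)) = Q z) ∧ ContDiffOn ℝ 1 Φ U ∧ ∀ p ∈ U, Function.Injective (fderiv ℝ Φ p))} → ∀ f : QuadConfig (univ : Set ℂ) → ℝ≥0∞, Measurable f → (∀ S, f S ≤ 2) → IsProbabilityMeasure (μ.toMeasure.withDensity f) → (∀ ε : ℝ, 0 < ε → IsFlipFairKernel (μ.toMeasure.withDensity f) (M ε)) → (∀ t : ℝ, 0 ≤ t → ∀ π : FiniteMeasure (QuadConfig (univ : Set ℂ)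 × QuadConfig (univ : Set ℂ)), (∃ φ : ℕ → ℕ, StrictMono φ ∧ ∀ F : BoundedContinuousFunction (QuadConfig (univ : Set ℂ) × QuadConfig (univ : Set ℂ)) ℝ, Tendsto (fun k => (∫ x, F (z2QuadConfig (univ : Set ℂ) (δs (φ k)) x.1.1, z2QuadConfig (univ : Set ℂ) (δs (φ k)) (resample x.2 (x.1.1, x.1.2))) ∂(((bondPercolation (zdGraph 2) half).prod (bondPercolation (zdGraph 2) half)).prod (bondPercolation (zdGraph 2) (Set.projIcc (0 : ℝ) 1 zero_le_one (1 - Real.exp (-(pivotalRate (δs (φ k)) * t)))))))) atTop (𝓝 (∫ p, F p ∂(π : Measure (QuadConfig (univ : Set ℂ) × QuadConfig (univ : Set ℂ)))))) → ∀ (n : ℕ) (Q : Fin n → Quad (univ : Set ℂ)), (∀ i, (∃ (U : Set (ℝ × ℝ)) (Φ : ℝ × ℝ → ℂ), IsOpen U ∧ (∀ z : unitInterval × unitInterval, (((z.1 : ℝ), (z.2 : ℝ)) : ℝ × ℝ) ∈ U ∧ Φ ((z.1 : ℝ), (z.2 : ℝ)) = Q i z) ∧ ContDiffOn ℝ 1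 Φ U ∧ ∀ p ∈ U, Function.Injective (fderiv ℝ Φ p))) → ∀ g : Set (Fin n) → ℝ, (∃ (C : ℝ) (G : ℝ → QuadConfig (univ : Set ℂ) → ℝ), (∀ ε, Measurable (G ε)) ∧ (∀ ε, 0 < ε → ∫ S, (G ε S) ^ 2 ∂μ.toMeasure ≤ C) ∧ (∀ ε, 0 < ε → ∀ f : QuadConfig (univ : Set ℂ) → ℝ≥0∞, Measurable f → (∀ S, f S ≤ 2) → (∀ ε', 0 < ε' → IsFlipFairKernel (μ.toMeasure.withDensity f) (M ε')) → ∫ S, (f S).toReal * G ε S ∂μ.toMeasure = 0) ∧ (∀ (m : ℕ) (Q' : Fin m → Quad (univ : Set ℂ)), (∀ i, (∃ (U : Set (ℝ × ℝ)) (Φ : ℝ × ℝ → ℂ), IsOpen U ∧ (∀ z : unitInterval × unitInterval, (((z.1 : ℝ), (z.2 : ℝ)) : ℝ × ℝ) ∈ U ∧ Φ ((z.1 : ℝ), (z.2 : ℝ)) = Q' i z) ∧ ContDiffOn ℝ 1 Φ U ∧ ∀ p ∈ U, Function.Injective (fderiv ℝ Φ p))) → ∀ g' : Set (Fin m) → ℝ,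 Tendsto (fun ε => t * ∫ S, g' {i | Q' i ∈ S} * G ε S ∂μ.toMeasure) (𝓝[>] 0) (𝓝 ((∫ p, g' {i | Q' i ∈ p.1} * g {i | Q i ∈ p.2} ∂(π : Measure (QuadConfig (univ : Set ℂ) × QuadConfig (univ : Set ℂ)))) - ∫ S, g' {i | Q' i ∈ S} * g {i | Q i ∈ S} ∂μ.toMeasure))))) → (∀ (n : ℕ) (Q : Fin n → Quad (univ : Set ℂ)), (∀ i, (∃ (U : Set (ℝ × ℝ)) (Φ : ℝ × ℝ → ℂ), IsOpen U ∧ (∀ z : unitInterval × unitInterval, (((z.1 : ℝ), (z.2 : ℝ)) : ℝ × ℝ) ∈ U ∧ Φ ((z.1 : ℝ), (z.2 : ℝ)) = Q i z) ∧ ContDiffOn ℝ 1 Φ U ∧ ∀ p ∈ U, Function.Injective (fderiv ℝ Φ p))) → ∀ (g : Set (Fin n) → ℝ) (η : ℝ), 0 < η → ∃ t : ℝ, 0 ≤ t ∧ ∃ π : FiniteMeasure (QuadConfig (univ : Set ℂ) × QuadConfig (univ : Set ℂ)), (∃ φ : ℕ → ℕ, StrictMono φ ∧ ∀ F : BoundedContinuousFunction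 (QuadConfig (univ : Set ℂ) × QuadConfig (univ : Set ℂ)) ℝ, Tendsto (fun k => (∫ x, F (z2QuadConfig (univ : Set ℂ) (δs (φ k)) x.1.1, z2QuadConfig (univ : Set ℂ) (δs (φ k)) (resample x.2 (x.1.1, x.1.2))) ∂(((bondPercolation (zdGraph 2) half).prod (bondPercolation (zdGraph 2) half)).prod (bondPercolation (zdGraph 2) (Set.projIcc (0 : ℝ) 1 zero_le_one (1 - Real.exp (-(pivotalRate (δs (φ k)) * t)))))))) atTop (𝓝 (∫ p, F p ∂(π : Measure (QuadConfig (univ : Set ℂ) × QuadConfig (univ : Set ℂ)))))) ∧ ∀ w : QuadConfig (univ : Set ℂ) → ℝ, Measurable w → (∀ S, |w S| ≤ 2) → |∫ p, w p.1 * (g {i | Q i ∈ p.2} - ∫ S, g {i | Q i ∈ S} ∂μ.toMeasure) ∂(π : Measure (QuadConfig (univ : Set ℂ) × QuadConfig (univ : Set ℂ)))| ≤ η) → μ.toMeasure.withDensity f = μ.toMeasure := by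
  sorry

/-- **Composition** (kernel-checked): the six stubs give the crux BY NAME, through the landed split
glue `flipErgodicityZ2_of_subs` (p172226) — stubs 3–6 prove the third child
`PivotalKernelErgodicZ2` (= birth `stub_pivotalKernelErgodic`) without using equivariance. -/
theorem FlipErgodicityZ2_of :
    (∀ μ : FiniteMeasure (QuadConfig (univ : Set ℂ)), μ ∈ subseqQuadLimits (univ : Set ℂ) → ∃ M : ℝ → QuadConfig (univ : Set ℂ) → Measure ℂ, IsZ2PivotalKernelLimit μ M ∧ IsAdmissibleKernel (μ : Measure (QuadConfig (univ : Set ℂ))) M ∧ IsIsometryEquivariant M) →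
    (∀ (μ : FiniteMeasure (QuadConfig (univ : Set ℂ))) (M : ℝ → QuadConfig (univ : Set ℂ) → Measure ℂ), IsZ2PivotalKernelLimit μ M → IsAdmissibleKernel (μ : Measure (QuadConfig (univ : Set ℂ))) M → ∀ ε : ℝ, 0 < ε → IsFlipFairKernel (μ : Measure (QuadConfig (univ : Set ℂ))) (M ε)) →
    (Dense {Q : Quad (univ : Set ℂ) | (∃ (U : Set (ℝ × ℝ)) (Φ : ℝ × ℝ → ℂ), IsOpen U ∧ (∀ z : unitInterval × unitInterval, (((z.1 : ℝ), (z.2 : ℝ)) : ℝ × ℝ) ∈ U ∧ Φ ((z.1 : ℝ), (z.2 : ℝ)) = Q z) ∧ ContDiffOn ℝ 1 Φ U ∧ ∀ p ∈ U, Function.Injective (fderiv ℝ Φ p))}) →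
    (∀ (μ : FiniteMeasure (QuadConfig (univ : Set ℂ))) (δs : ℕ → ℝ), (∀ k, 0 < δs k) → Tendsto δs atTop (𝓝 0) → Tendsto (fun k => z2QuadLaw (univ : Set ℂ) (δs k)) atTop (𝓝 μ) → (∀ (n : ℕ) (Q : Fin n → Quad (univ : Set ℂ)), (∀ i, (∃ (U : Set (ℝ × ℝ)) (Φ : ℝ × ℝ → ℂ), IsOpen U ∧ (∀ z : unitInterval × unitInterval, (((z.1 : ℝ), (z.2 : ℝ)) : ℝ × ℝ) ∈ U ∧ Φ ((z.1 : ℝ), (z.2 : ℝ)) = Q i z) ∧ ContDiffOn ℝ 1 Φ U ∧ ∀ p ∈ U, Function.Injective (fderiv ℝ Φ p))) → ∀ (g : Set (Fin n) → ℝ) (η : ℝ), 0 < η → ∃ t : ℝ, 0 ≤ t ∧ ∃ π : FiniteMeasure (QuadConfig (univ : Set ℂ) × QuadConfig (univ : Set ℂ)), (∃ φ : ℕ → ℕ, StrictMono φ ∧ ∀ F : BoundedContinuousFunction (QuadConfig (univ : Set ℂ) × QuadConfig (univ : Set ℂ)) ℝ, Tendsto (fun k => (∫ x, F (z2QuadConfig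 (univ : Set ℂ) (δs (φ k)) x.1.1, z2QuadConfig (univ : Set ℂ) (δs (φ k)) (resample x.2 (x.1.1, x.1.2))) ∂(((bondPercolation (zdGraph 2) half).prod (bondPercolation (zdGraph 2) half)).prod (bondPercolation (zdGraph 2) (Set.projIcc (0 : ℝ) 1 zero_le_one (1 - Real.exp (-(pivotalRate (δs (φ k)) * t)))))))) atTop (𝓝 (∫ p, F p ∂(π : Measure (QuadConfig (univ : Set ℂ) × QuadConfig (univ : Set ℂ)))))) ∧ ∀ w : QuadConfig (univ : Set ℂ) → ℝ, Measurable w → (∀ S, |w S| ≤ 2) → |∫ p, w p.1 * (g {i | Q i ∈ p.2} - ∫ S, g {i | Q i ∈ S} ∂(μ : Measure (QuadConfig (univ : Set ℂ)))) ∂(π : Measure (QuadConfig (univ : Set ℂ) × QuadConfig (univ : Set ℂ)))| ≤ η)) →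
    (∀ (μ : FiniteMeasure (QuadConfig (univ : Set ℂ))) (M : ℝ → QuadConfig (univ : Set ℂ) → Measure ℂ) (δs : ℕ → ℝ), (∀ k, 0 < δs k) → Tendsto δs atTop (𝓝 0) → Tendsto (fun k => z2QuadLaw (univ : Set ℂ) (δs k)) atTop (𝓝 μ) → (∀ ε : ℝ, 0 < ε → ∀ (m : ℕ) (φ : Fin m → ℂ → ℝ), (∀ j, Continuous (φ j)) → (∀ j, HasCompactSupport (φ j)) → ∀ F : BoundedContinuousFunction (QuadConfig (univ : Set ℂ) × (Fin m → ℝ)) ℝ, Tendsto (fun k => ∫ ω, F (z2QuadConfig (univ : Set ℂ) (δs k) ω, fun j => ∫ x, φ j x ∂(z2PivotalMeasure ε (δs k) ω)) ∂(bondPercolation (zdGraph 2) half)) atTop (𝓝 (∫ S, F (S, fun j => ∫ x, φ j x ∂(M ε S)) ∂(μ : Measure (QuadConfig (univ : Set ℂ)))))) → IsAdmissibleKernel (μ : Measure (QuadConfig (univ : Set ℂ))) M → (∀ ε : ℝ, 0 < ε → IsFlipFairKernel (μ : Measure (QuadConfig (univ : Set ℂ))) (M ε)) → (∀ t : ℝ,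 0 ≤ t → ∀ π : FiniteMeasure (QuadConfig (univ : Set ℂ) × QuadConfig (univ : Set ℂ)), (∃ φ : ℕ → ℕ, StrictMono φ ∧ ∀ F : BoundedContinuousFunction (QuadConfig (univ : Set ℂ) × QuadConfig (univ : Set ℂ)) ℝ, Tendsto (fun k => (∫ x, F (z2QuadConfig (univ : Set ℂ) (δs (φ k)) x.1.1, z2QuadConfig (univ : Set ℂ) (δs (φ k)) (resample x.2 (x.1.1, x.1.2))) ∂(((bondPercolation (zdGraph 2) half).prod (bondPercolation (zdGraph 2) half)).prod (bondPercolation (zdGraph 2) (Set.projIcc (0 : ℝ) 1 zero_le_one (1 - Real.exp (-(pivotalRate (δs (φ k)) * t)))))))) atTop (𝓝 (∫ p, F p ∂(π : Measure (QuadConfig (univ : Set ℂ) × QuadConfig (univ : Set ℂ)))))) → ∀ (n : ℕ) (Q : Fin n → Quad (univ : Set ℂ)), (∀ i, (∃ (U : Set (ℝ × ℝ)) (Φ : ℝ × ℝ → ℂ), IsOpen U ∧ (∀ z : unitInterval × unitInterval, (((z.1 : ℝ), (z.2 : ℝ)) : ℝ × ℝ) ∈ U ∧ Φ ((z.1 :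 ℝ), (z.2 : ℝ)) = Q i z) ∧ ContDiffOn ℝ 1 Φ U ∧ ∀ p ∈ U, Function.Injective (fderiv ℝ Φ p))) → ∀ g : Set (Fin n) → ℝ, (∃ (C : ℝ) (G : ℝ → QuadConfig (univ : Set ℂ) → ℝ), (∀ ε, Measurable (G ε)) ∧ (∀ ε, 0 < ε → ∫ S, (G ε S) ^ 2 ∂(μ : Measure (QuadConfig (univ : Set ℂ))) ≤ C) ∧ (∀ ε, 0 < ε → ∀ f : QuadConfig (univ : Set ℂ) → ℝ≥0∞, Measurable f → (∀ S, f S ≤ 2) → (∀ ε', 0 < ε' → IsFlipFairKernel ((μ : Measure (QuadConfig (univ : Set ℂ))).withDensity f) (M ε')) → ∫ S, (f S).toReal * G ε S ∂(μ : Measure (QuadConfig (univ : Set ℂ))) = 0) ∧ (∀ (m : ℕ) (Q' : Fin m → Quad (univ : Set ℂ)), (∀ i, (∃ (U : Set (ℝ × ℝ)) (Φ : ℝ × ℝ → ℂ), IsOpen U ∧ (∀ z : unitInterval × unitInterval, (((z.1 : ℝ), (z.2 : ℝ)) : ℝ × ℝ) ∈ U ∧ Φ ((z.1 : ℝ), (z.2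 : ℝ)) = Q' i z) ∧ ContDiffOn ℝ 1 Φ U ∧ ∀ p ∈ U, Function.Injective (fderiv ℝ Φ p))) → ∀ g' : Set (Fin m) → ℝ, Tendsto (fun ε => t * ∫ S, g' {i | Q' i ∈ S} * G ε S ∂(μ : Measure (QuadConfig (univ : Set ℂ)))) (𝓝[>] 0) (𝓝 ((∫ p, g' {i | Q' i ∈ p.1} * g {i | Q i ∈ p.2} ∂(π : Measure (QuadConfig (univ : Set ℂ) × QuadConfig (univ : Set ℂ)))) - ∫ S, g' {i | Q' i ∈ S} * g {i | Q i ∈ S} ∂(μ : Measure (QuadConfig (univ : Set ℂ))))))))) →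
    (∀ (μ : FiniteMeasure (QuadConfig (univ : Set ℂ))) (M : ℝ → QuadConfig (univ : Set ℂ) → Measure ℂ) (δs : ℕ → ℝ), (∀ k, 0 < δs k) → Tendsto δs atTop (𝓝 0) → Tendsto (fun k => z2QuadLaw (univ : Set ℂ) (δs k)) atTop (𝓝 μ) → Dense {Q : Quad (univ : Set ℂ) | (∃ (U : Set (ℝ × ℝ)) (Φ : ℝ × ℝ → ℂ), IsOpen U ∧ (∀ z : unitInterval × unitInterval, (((z.1 : ℝ), (z.2 : ℝ)) : ℝ × ℝ) ∈ U ∧ Φ ((z.1 : ℝ), (z.2 : ℝ)) = Q z) ∧ ContDiffOn ℝ 1 Φ U ∧ ∀ p ∈ U, Function.Injective (fderiv ℝ Φ p))} → ∀ f : QuadConfig (univ : Set ℂ) → ℝ≥0∞, Measurable f → (∀ S, f S ≤ 2) → IsProbabilityMeasure (μ.toMeasure.withDensity f) → (∀ ε : ℝ, 0 < ε → IsFlipFairKernel (μ.toMeasure.withDensity f) (M ε)) → (∀ t : ℝ, 0 ≤ t → ∀ π : FiniteMeasure (QuadConfig (univ : Set ℂ) × QuadConfig (univ : Set ℂ)),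 (∃ φ : ℕ → ℕ, StrictMono φ ∧ ∀ F : BoundedContinuousFunction (QuadConfig (univ : Set ℂ) × QuadConfig (univ : Set ℂ)) ℝ, Tendsto (fun k => (∫ x, F (z2QuadConfig (univ : Set ℂ) (δs (φ k)) x.1.1, z2QuadConfig (univ : Set ℂ) (δs (φ k)) (resample x.2 (x.1.1, x.1.2))) ∂(((bondPercolation (zdGraph 2) half).prod (bondPercolation (zdGraph 2) half)).prod (bondPercolation (zdGraph 2) (Set.projIcc (0 : ℝ) 1 zero_le_one (1 - Real.exp (-(pivotalRate (δs (φ k)) * t)))))))) atTop (𝓝 (∫ p, F p ∂(π : Measure (QuadConfig (univ : Set ℂ) × QuadConfig (univ : Set ℂ)))))) → ∀ (n : ℕ) (Q : Fin n → Quad (univ : Set ℂ)), (∀ i, (∃ (U : Set (ℝ × ℝ)) (Φ : ℝ × ℝ → ℂ), IsOpen U ∧ (∀ z : unitInterval × unitInterval, (((z.1 : ℝ), (z.2 : ℝ)) : ℝ × ℝ) ∈ U ∧ Φ ((z.1 : ℝ), (z.2 : ℝ)) = Q i z) ∧ ContDiffOn ℝ 1 Φ U ∧ ∀ p ∈ U,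 Function.Injective (fderiv ℝ Φ p))) → ∀ g : Set (Fin n) → ℝ, (∃ (C : ℝ) (G : ℝ → QuadConfig (univ : Set ℂ) → ℝ), (∀ ε, Measurable (G ε)) ∧ (∀ ε, 0 < ε → ∫ S, (G ε S) ^ 2 ∂μ.toMeasure ≤ C) ∧ (∀ ε, 0 < ε → ∀ f : QuadConfig (univ : Set ℂ) → ℝ≥0∞, Measurable f → (∀ S, f S ≤ 2) → (∀ ε', 0 < ε' → IsFlipFairKernel (μ.toMeasure.withDensity f) (M ε')) → ∫ S, (f S).toReal * G ε S ∂μ.toMeasure = 0) ∧ (∀ (m : ℕ) (Q' : Fin m → Quad (univ : Set ℂ)), (∀ i, (∃ (U : Set (ℝ × ℝ)) (Φ : ℝ × ℝ → ℂ), IsOpen U ∧ (∀ z : unitInterval × unitInterval, (((z.1 : ℝ), (z.2 : ℝ)) : ℝ × ℝ) ∈ U ∧ Φ ((z.1 : ℝ), (z.2 : ℝ)) = Q' i z) ∧ ContDiffOn ℝ 1 Φ U ∧ ∀ p ∈ U, Function.Injective (fderiv ℝ Φ p))) → ∀ g' : Set (Fin m) → ℝ, Tendsto (fun ε => t * ∫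 S, g' {i | Q' i ∈ S} * G ε S ∂μ.toMeasure) (𝓝[>] 0) (𝓝 ((∫ p, g' {i | Q' i ∈ p.1} * g {i | Q i ∈ p.2} ∂(π : Measure (QuadConfig (univ : Set ℂ) × QuadConfig (univ : Set ℂ)))) - ∫ S, g' {i | Q' i ∈ S} * g {i | Q i ∈ S} ∂μ.toMeasure))))) → (∀ (n : ℕ) (Q : Fin n → Quad (univ : Set ℂ)), (∀ i, (∃ (U : Set (ℝ × ℝ)) (Φ : ℝ × ℝ → ℂ), IsOpen U ∧ (∀ z : unitInterval × unitInterval, (((z.1 : ℝ), (z.2 : ℝ)) : ℝ × ℝ) ∈ U ∧ Φ ((z.1 : ℝ), (z.2 : ℝ)) = Q i z) ∧ ContDiffOn ℝ 1 Φ U ∧ ∀ p ∈ U, Function.Injective (fderiv ℝ Φ p))) → ∀ (g : Set (Fin n) → ℝ) (η : ℝ), 0 < η → ∃ t : ℝ, 0 ≤ t ∧ ∃ π : FiniteMeasure (QuadConfig (univ : Set ℂ) × QuadConfig (univ : Set ℂ)), (∃ φ : ℕ → ℕ, StrictMono φ ∧ ∀ F : BoundedContinuousFunction (QuadConfig (univ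 : Set ℂ) × QuadConfig (univ : Set ℂ)) ℝ, Tendsto (fun k => (∫ x, F (z2QuadConfig (univ : Set ℂ) (δs (φ k)) x.1.1, z2QuadConfig (univ : Set ℂ) (δs (φ k)) (resample x.2 (x.1.1, x.1.2))) ∂(((bondPercolation (zdGraph 2) half).prod (bondPercolation (zdGraph 2) half)).prod (bondPercolation (zdGraph 2) (Set.projIcc (0 : ℝ) 1 zero_le_one (1 - Real.exp (-(pivotalRate (δs (φ k)) * t)))))))) atTop (𝓝 (∫ p, F p ∂(π : Measure (QuadConfig (univ : Set ℂ) × QuadConfig (univ : Set ℂ)))))) ∧ ∀ w : QuadConfig (univ : Set ℂ) → ℝ, Measurable w → (∀ S, |w S| ≤ 2) → |∫ p, w p.1 * (g {i | Q i ∈ p.2} - ∫ S, g {i | Q i ∈ S} ∂μ.toMeasure) ∂(π : Measure (QuadConfig (univ : Set ℂ) × QuadConfig (univ : Set ℂ)))| ≤ η) → μ.toMeasure.withDensity f = μ.toMeasure) →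
    Summit.CriticalPhenomena.CardyFormulaZ2.Theses.CardyMeckeFlip.FlipErgodicityZ2 := by
  intro hK hF hD hMix hGen hErg
  refine flipErgodicityZ2_of_subs' hK hF ?_
  intro μ M hlim hadm _hequiv hff f hf hf2 hP hffP
  obtain ⟨δs, hpos, h0, hlaw, hjoint⟩ := hlim
  exact hErg μ M δs hpos h0 hlaw hD f hf hf2 hP hffP
    (fun t ht π hπ n Q hQ g => hGen μ M δs hpos h0 hlaw hjoint hadm hff t ht π hπ n Q hQ g)
    (fun n Q hQ g η hη => hMix μ δs hpos h0 hlaw n Q hQ g η hη)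

/-- The ergodic child alone (= birth `stub_pivotalKernelErgodic` / split child
`PivotalKernelErgodicZ2`, verbatim) from stubs 3–6 — recorded so that a lead on the birth line can
import this line's ergodic half without switching lines. -/
theorem pivotalKernelErgodic_of :
    (Dense {Q : Quad (univ : Set ℂ) | (∃ (U : Set (ℝ × ℝ)) (Φ : ℝ × ℝ → ℂ), IsOpen U ∧ (∀ z : unitInterval × unitInterval, (((z.1 : ℝ), (z.2 : ℝ)) : ℝ × ℝ) ∈ U ∧ Φ ((z.1 : ℝ), (z.2 : ℝ)) = Q z) ∧ ContDiffOn ℝ 1 Φ U ∧ ∀ p ∈ U, Function.Injective (fderiv ℝ Φ p))}) →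
    (∀ (μ : FiniteMeasure (QuadConfig (univ : Set ℂ))) (δs : ℕ → ℝ), (∀ k, 0 < δs k) → Tendsto δs atTop (𝓝 0) → Tendsto (fun k => z2QuadLaw (univ : Set ℂ) (δs k)) atTop (𝓝 μ) → (∀ (n : ℕ) (Q : Fin n → Quad (univ : Set ℂ)), (∀ i, (∃ (U : Set (ℝ × ℝ)) (Φ : ℝ × ℝ → ℂ), IsOpen U ∧ (∀ z : unitInterval × unitInterval, (((z.1 : ℝ), (z.2 : ℝ)) : ℝ × ℝ) ∈ U ∧ Φ ((z.1 : ℝ), (z.2 : ℝ)) = Q i z) ∧ ContDiffOn ℝ 1 Φ U ∧ ∀ p ∈ U, Function.Injective (fderiv ℝ Φ p))) → ∀ (g : Set (Fin n) → ℝ) (η : ℝ), 0 < η → ∃ t : ℝ, 0 ≤ t ∧ ∃ π : FiniteMeasure (QuadConfig (univ : Set ℂ) × QuadConfig (univ : Set ℂ)), (∃ φ : ℕ → ℕ, StrictMono φ ∧ ∀ F : BoundedContinuousFunction (QuadConfig (univ : Set ℂ) × QuadConfig (univ : Set ℂ)) ℝ, Tendsto (fun k => (∫ x, F (z2QuadConfig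 (univ : Set ℂ) (δs (φ k)) x.1.1, z2QuadConfig (univ : Set ℂ) (δs (φ k)) (resample x.2 (x.1.1, x.1.2))) ∂(((bondPercolation (zdGraph 2) half).prod (bondPercolation (zdGraph 2) half)).prod (bondPercolation (zdGraph 2) (Set.projIcc (0 : ℝ) 1 zero_le_one (1 - Real.exp (-(pivotalRate (δs (φ k)) * t)))))))) atTop (𝓝 (∫ p, F p ∂(π : Measure (QuadConfig (univ : Set ℂ) × QuadConfig (univ : Set ℂ)))))) ∧ ∀ w : QuadConfig (univ : Set ℂ) → ℝ, Measurable w → (∀ S, |w S| ≤ 2) → |∫ p, w p.1 * (g {i | Q i ∈ p.2} - ∫ S, g {i | Q i ∈ S} ∂(μ : Measure (QuadConfig (univ : Set ℂ)))) ∂(π : Measure (QuadConfig (univ : Set ℂ) × QuadConfig (univ : Set ℂ)))| ≤ η)) →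
    (∀ (μ : FiniteMeasure (QuadConfig (univ : Set ℂ))) (M : ℝ → QuadConfig (univ : Set ℂ) → Measure ℂ) (δs : ℕ → ℝ), (∀ k, 0 < δs k) → Tendsto δs atTop (𝓝 0) → Tendsto (fun k => z2QuadLaw (univ : Set ℂ) (δs k)) atTop (𝓝 μ) → (∀ ε : ℝ, 0 < ε → ∀ (m : ℕ) (φ : Fin m → ℂ → ℝ), (∀ j, Continuous (φ j)) → (∀ j, HasCompactSupport (φ j)) → ∀ F : BoundedContinuousFunction (QuadConfig (univ : Set ℂ) × (Fin m → ℝ)) ℝ, Tendsto (fun k => ∫ ω, F (z2QuadConfig (univ : Set ℂ) (δs k) ω, fun j => ∫ x, φ j x ∂(z2PivotalMeasure ε (δs k) ω)) ∂(bondPercolation (zdGraph 2) half)) atTop (𝓝 (∫ S, F (S, fun j => ∫ x, φ j x ∂(M ε S)) ∂(μ : Measure (QuadConfig (univ : Set ℂ)))))) → IsAdmissibleKernel (μ : Measure (QuadConfig (univ : Set ℂ))) M → (∀ ε : ℝ, 0 < ε → IsFlipFairKernel (μ : Measure (QuadConfig (univ : Set ℂ))) (M ε)) → (∀ t : ℝ,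 0 ≤ t → ∀ π : FiniteMeasure (QuadConfig (univ : Set ℂ) × QuadConfig (univ : Set ℂ)), (∃ φ : ℕ → ℕ, StrictMono φ ∧ ∀ F : BoundedContinuousFunction (QuadConfig (univ : Set ℂ) × QuadConfig (univ : Set ℂ)) ℝ, Tendsto (fun k => (∫ x, F (z2QuadConfig (univ : Set ℂ) (δs (φ k)) x.1.1, z2QuadConfig (univ : Set ℂ) (δs (φ k)) (resample x.2 (x.1.1, x.1.2))) ∂(((bondPercolation (zdGraph 2) half).prod (bondPercolation (zdGraph 2) half)).prod (bondPercolation (zdGraph 2) (Set.projIcc (0 : ℝ) 1 zero_le_one (1 - Real.exp (-(pivotalRate (δs (φ k)) * t)))))))) atTop (𝓝 (∫ p, F p ∂(π : Measure (QuadConfig (univ : Set ℂ) × QuadConfig (univ : Set ℂ)))))) → ∀ (n : ℕ) (Q : Fin n → Quad (univ : Set ℂ)), (∀ i, (∃ (U : Set (ℝ × ℝ)) (Φ : ℝ × ℝ → ℂ), IsOpen U ∧ (∀ z : unitInterval × unitInterval, (((z.1 : ℝ), (z.2 : ℝ)) : ℝ × ℝ) ∈ U ∧ Φ ((z.1 :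 ℝ), (z.2 : ℝ)) = Q i z) ∧ ContDiffOn ℝ 1 Φ U ∧ ∀ p ∈ U, Function.Injective (fderiv ℝ Φ p))) → ∀ g : Set (Fin n) → ℝ, (∃ (C : ℝ) (G : ℝ → QuadConfig (univ : Set ℂ) → ℝ), (∀ ε, Measurable (G ε)) ∧ (∀ ε, 0 < ε → ∫ S, (G ε S) ^ 2 ∂(μ : Measure (QuadConfig (univ : Set ℂ))) ≤ C) ∧ (∀ ε, 0 < ε → ∀ f : QuadConfig (univ : Set ℂ) → ℝ≥0∞, Measurable f → (∀ S, f S ≤ 2) → (∀ ε', 0 < ε' → IsFlipFairKernel ((μ : Measure (QuadConfig (univ : Set ℂ))).withDensity f) (M ε')) → ∫ S, (f S).toReal * G ε S ∂(μ : Measure (QuadConfig (univ : Set ℂ))) = 0) ∧ (∀ (m : ℕ) (Q' : Fin m → Quad (univ : Set ℂ)), (∀ i, (∃ (U : Set (ℝ × ℝ)) (Φ : ℝ × ℝ → ℂ), IsOpen U ∧ (∀ z : unitInterval × unitInterval, (((z.1 : ℝ), (z.2 : ℝ)) : ℝ × ℝ) ∈ U ∧ Φ ((z.1 : ℝ), (z.2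 : ℝ)) = Q' i z) ∧ ContDiffOn ℝ 1 Φ U ∧ ∀ p ∈ U, Function.Injective (fderiv ℝ Φ p))) → ∀ g' : Set (Fin m) → ℝ, Tendsto (fun ε => t * ∫ S, g' {i | Q' i ∈ S} * G ε S ∂(μ : Measure (QuadConfig (univ : Set ℂ)))) (𝓝[>] 0) (𝓝 ((∫ p, g' {i | Q' i ∈ p.1} * g {i | Q i ∈ p.2} ∂(π : Measure (QuadConfig (univ : Set ℂ) × QuadConfig (univ : Set ℂ)))) - ∫ S, g' {i | Q' i ∈ S} * g {i | Q i ∈ S} ∂(μ : Measure (QuadConfig (univ : Set ℂ))))))))) →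
    (∀ (μ : FiniteMeasure (QuadConfig (univ : Set ℂ))) (M : ℝ → QuadConfig (univ : Set ℂ) → Measure ℂ) (δs : ℕ → ℝ), (∀ k, 0 < δs k) → Tendsto δs atTop (𝓝 0) → Tendsto (fun k => z2QuadLaw (univ : Set ℂ) (δs k)) atTop (𝓝 μ) → Dense {Q : Quad (univ : Set ℂ) | (∃ (U : Set (ℝ × ℝ)) (Φ : ℝ × ℝ → ℂ), IsOpen U ∧ (∀ z : unitInterval × unitInterval, (((z.1 : ℝ), (z.2 : ℝ)) : ℝ × ℝ) ∈ U ∧ Φ ((z.1 : ℝ), (z.2 : ℝ)) = Q z) ∧ ContDiffOn ℝ 1 Φ U ∧ ∀ p ∈ U, Function.Injective (fderiv ℝ Φ p))} → ∀ f : QuadConfig (univ : Set ℂ) → ℝ≥0∞, Measurable f → (∀ S, f S ≤ 2) → IsProbabilityMeasure (μ.toMeasure.withDensity f) → (∀ ε : ℝ, 0 < ε → IsFlipFairKernel (μ.toMeasure.withDensity f) (M ε)) → (∀ t : ℝ, 0 ≤ t → ∀ π : FiniteMeasure (QuadConfig (univ : Set ℂ) × QuadConfig (univ : Set ℂ)),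 (∃ φ : ℕ → ℕ, StrictMono φ ∧ ∀ F : BoundedContinuousFunction (QuadConfig (univ : Set ℂ) × QuadConfig (univ : Set ℂ)) ℝ, Tendsto (fun k => (∫ x, F (z2QuadConfig (univ : Set ℂ) (δs (φ k)) x.1.1, z2QuadConfig (univ : Set ℂ) (δs (φ k)) (resample x.2 (x.1.1, x.1.2))) ∂(((bondPercolation (zdGraph 2) half).prod (bondPercolation (zdGraph 2) half)).prod (bondPercolation (zdGraph 2) (Set.projIcc (0 : ℝ) 1 zero_le_one (1 - Real.exp (-(pivotalRate (δs (φ k)) * t)))))))) atTop (𝓝 (∫ p, F p ∂(π : Measure (QuadConfig (univ : Set ℂ) × QuadConfig (univ : Set ℂ)))))) → ∀ (n : ℕ) (Q : Fin n → Quad (univ : Set ℂ)), (∀ i, (∃ (U : Set (ℝ × ℝ)) (Φ : ℝ × ℝ → ℂ), IsOpen U ∧ (∀ z : unitInterval × unitInterval, (((z.1 : ℝ), (z.2 : ℝ)) : ℝ × ℝ) ∈ U ∧ Φ ((z.1 : ℝ), (z.2 : ℝ)) = Q i z) ∧ ContDiffOn ℝ 1 Φ U ∧ ∀ p ∈ U,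 Function.Injective (fderiv ℝ Φ p))) → ∀ g : Set (Fin n) → ℝ, (∃ (C : ℝ) (G : ℝ → QuadConfig (univ : Set ℂ) → ℝ), (∀ ε, Measurable (G ε)) ∧ (∀ ε, 0 < ε → ∫ S, (G ε S) ^ 2 ∂μ.toMeasure ≤ C) ∧ (∀ ε, 0 < ε → ∀ f : QuadConfig (univ : Set ℂ) → ℝ≥0∞, Measurable f → (∀ S, f S ≤ 2) → (∀ ε', 0 < ε' → IsFlipFairKernel (μ.toMeasure.withDensity f) (M ε')) → ∫ S, (f S).toReal * G ε S ∂μ.toMeasure = 0) ∧ (∀ (m : ℕ) (Q' : Fin m → Quad (univ : Set ℂ)), (∀ i, (∃ (U : Set (ℝ × ℝ)) (Φ : ℝ × ℝ → ℂ), IsOpen U ∧ (∀ z : unitInterval × unitInterval, (((z.1 : ℝ), (z.2 : ℝ)) : ℝ × ℝ) ∈ U ∧ Φ ((z.1 : ℝ), (z.2 : ℝ)) = Q' i z) ∧ ContDiffOn ℝ 1 Φ U ∧ ∀ p ∈ U, Function.Injective (fderiv ℝ Φ p))) → ∀ g' : Set (Fin m) → ℝ, Tendsto (fun ε => t * ∫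 S, g' {i | Q' i ∈ S} * G ε S ∂μ.toMeasure) (𝓝[>] 0) (𝓝 ((∫ p, g' {i | Q' i ∈ p.1} * g {i | Q i ∈ p.2} ∂(π : Measure (QuadConfig (univ : Set ℂ) × QuadConfig (univ : Set ℂ)))) - ∫ S, g' {i | Q' i ∈ S} * g {i | Q i ∈ S} ∂μ.toMeasure))))) → (∀ (n : ℕ) (Q : Fin n → Quad (univ : Set ℂ)), (∀ i, (∃ (U : Set (ℝ × ℝ)) (Φ : ℝ × ℝ → ℂ), IsOpen U ∧ (∀ z : unitInterval × unitInterval, (((z.1 : ℝ), (z.2 : ℝ)) : ℝ × ℝ) ∈ U ∧ Φ ((z.1 : ℝ), (z.2 : ℝ)) = Q i z) ∧ ContDiffOn ℝ 1 Φ U ∧ ∀ p ∈ U, Function.Injective (fderiv ℝ Φ p))) → ∀ (g : Set (Fin n) → ℝ) (η : ℝ), 0 < η → ∃ t : ℝ, 0 ≤ t ∧ ∃ π : FiniteMeasure (QuadConfig (univ : Set ℂ) × QuadConfig (univ : Set ℂ)), (∃ φ : ℕ → ℕ, StrictMono φ ∧ ∀ F : BoundedContinuousFunction (QuadConfig (univ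 : Set ℂ) × QuadConfig (univ : Set ℂ)) ℝ, Tendsto (fun k => (∫ x, F (z2QuadConfig (univ : Set ℂ) (δs (φ k)) x.1.1, z2QuadConfig (univ : Set ℂ) (δs (φ k)) (resample x.2 (x.1.1, x.1.2))) ∂(((bondPercolation (zdGraph 2) half).prod (bondPercolation (zdGraph 2) half)).prod (bondPercolation (zdGraph 2) (Set.projIcc (0 : ℝ) 1 zero_le_one (1 - Real.exp (-(pivotalRate (δs (φ k)) * t)))))))) atTop (𝓝 (∫ p, F p ∂(π : Measure (QuadConfig (univ : Set ℂ) × QuadConfig (univ : Set ℂ)))))) ∧ ∀ w : QuadConfig (univ : Set ℂ) → ℝ, Measurable w → (∀ S, |w S| ≤ 2) → |∫ p, w p.1 * (g {i | Q i ∈ p.2} - ∫ S, g {i | Q i ∈ S} ∂μ.toMeasure) ∂(π : Measure (QuadConfig (univ : Set ℂ) × QuadConfig (univ : Set ℂ)))| ≤ η) → μ.toMeasure.withDensity f = μ.toMeasure) →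
    ∀ (μ : FiniteMeasure (QuadConfig (univ : Set ℂ))) (M : ℝ → QuadConfig (univ : Set ℂ) → Measure ℂ),
      IsZ2PivotalKernelLimit μ M → IsAdmissibleKernel (μ : Measure (QuadConfig (univ : Set ℂ))) M → IsIsometryEquivariant M →
      (∀ ε : ℝ, 0 < ε → IsFlipFairKernel (μ : Measure (QuadConfig (univ : Set ℂ))) (M ε)) →
      ∀ f : QuadConfig (univ : Set ℂ) → ℝ≥0∞, Measurable f → (∀ S, f S ≤ 2) →
      IsProbabilityMeasure ((μ : Measure (QuadConfig (univ : Set ℂ))).withDensity f) →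
      (∀ ε : ℝ, 0 < ε → IsFlipFairKernel ((μ : Measure (QuadConfig (univ : Set ℂ))).withDensity f) (M ε)) →
      (μ : Measure (QuadConfig (univ : Set ℂ))).withDensity f = (μ : Measure (QuadConfig (univ : Set ℂ))) := by
  intro hD hMix hGen hErg μ M hlim hadm _hequiv hff f hf hf2 hP hffP
  obtain ⟨δs, hpos, h0, hlaw, hjoint⟩ := hlim
  exact hErg μ M δs hpos h0 hlaw hD f hf hf2 hP hffP
    (fun t ht π hπ n Q hQ g => hGen μ M δs hpos h0 hlaw hjoint hadm hff t ht π hπ n Q hQ g)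
    (fun n Q hQ g η hη => hMix μ δs hpos h0 hlaw n Q hQ g η hη)

end Summit.CriticalPhenomena.CardyFormulaZ2.Cruxes.FlipErgodicityZ2.Coupling
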